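import Summits.QuantumFields.YangMills.Theorems.VirialFluxGapPeriodicSoftnessOfCentralDrive
import Summits.QuantumFields.YangMills.Theorems.VirialFluxGapCentralFieldDivergence
import HarnessLib

/-!
# Route `VirialFluxGap` (YangMills): `PeriodicSoftness` FROM THE DRIVE (P2) OF THE EXPLICIT CENTRAL FIELD ALONE
# (assembly Part IX: (P3) is now w2 g53's ✓`central_divergence_window`; only the drive inequality of `centralCoeff` remains a hypothesis)

Toward the deciding crux `VirialFluxGap.PeriodicSoftness` (item stmt-QuantumFields-24141).  ✓`periodicSoftness_of_centralDrive` (Part VIII) reduced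
the crux to (P2) + (P3) for w3's explicit field `centralCoeff L σ σ₄`; w2 g53's ✓`CentralField.central_divergence_window` IS (P3) on the closed
`ρ`-central window for `ρ ≤ 1/5`, `t_C ≤ (4096L⁴)⁻¹` (no sign hypothesis).  Hence ★★★ `periodicSoftness_of_drive`: the crux holds BY NAME as soon
as, for all large `L`, there are `ρ ∈ [(K_C L^{q_C})⁻¹, 1/5]`, `t_C ∈ [(K_C L^{q_C})⁻¹, (110000·L⁴)⁻¹]`, `ε_C` with `ε_C·L⁴ ≤ 1/400` such that for all
signs `σ_k, σ₄ = ±1` and every `x ∈ X_fix` with all four regularity masses `≤ ρ²`, `½ ≤ σ_k·Re q(w_k)`, `½ ≤ σ₄·Re q(seam root)`, `F_fix x ≤ t_C`: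
  (P2)  `2(1 − ε_C)·F_fix x ≤ Σ_va centralCoeff L σ σ₄ va M_x · frameGrad fixFrameStd M_x va`.

HONEST LABEL: a CONDITIONAL reduction ((P2) is the HYPOTHESIS — w3 g59's Euler-defect programme F1 ✓`EulerDefectAlgebra` ∕ F2 ∕ F3, w2 g53's
quaternion reading); nothing is closed; ⟨24141⟩, ⟨22884⟩ remain OPEN; the Yang–Mills mass gap is NOT proved; no summit is proved by a line.
THEOREMS ONLY (0 `def`, 0 `sorry`), standard axioms.  Explicit-unit seat `ym-line-fcl-p3` g41 (cell ym-idea-1, free hands; assembler),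
`--supports stmt-QuantumFields-24141`.  References: [cite: Luscher1983, §2]; [cite: CosteEtAl1985]; [folklore].
-/

set_option autoImplicit false

noncomputable section

open scoped Matrix BigOperators ContDiff Topology Quaternion
open MeasureTheory Set Matrix
open Literature.MathematicalPhysics.QuantumFieldTheory hiding SU2
open Literature.MathematicalPhysics.QuantumLattice
open Literature.MathematicalPhysics.QuantumFieldTheory.SUNBakryEmery (expSU coe_expSU matTop)

namespace Summit.QuantumFields.YangMills.Theorems.VirialFluxGap.FrameHessian

open Summit.QuantumFields.YangMills.Theorems.FemtoTransferGap
open Summit.QuantumFields.YangMills.Theorems.FemtoTransferGap.TT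
open Summit.QuantumFields.YangMills.Theorems.FemtoTransferGap.TwoLattice
open Summit.QuantumFields.YangMills.Theorems.FemtoTransferGap.TwoLattice.Flat
open Summit.QuantumFields.YangMills.Theorems.VirialFluxGap.RingDeficit
open Summit.QuantumFields.YangMills.Theorems.VirialFluxGap.FrameDerivative
open Summit.QuantumFields.YangMills.Theorems.VirialFluxGap.FixFrame
open Summit.QuantumFields.YangMills.Theorems.VirialFluxGap.RegCutoff
open Summit.QuantumFields.YangMills.Theorems.VirialFluxGap.CentralField

variable {L : ℕ} [NeZero L]

open scoped Matrix.Norms.Frobenius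

/-- ★★★ **`PeriodicSoftness` FROM THE DRIVE OF THE EXPLICIT CENTRAL FIELD ALONE.**  If for all large `L` there are
`ρ ∈ [(K_C L^{q_C})⁻¹, 1/5]`, `t_C ∈ [(K_C L^{q_C})⁻¹, (110000·L⁴)⁻¹]` and `ε_C` with `ε_C·L⁴ ≤ 1/400` such that for all signs `σ_k, σ₄ = ±1`, at
every `x ∈ X_fix` with all four regularity masses `≤ ρ²`, `½ ≤ σ_k·Re q(w_k)`, `½ ≤ σ₄·Re q(seam root)` and `F_fix x ≤ t_C` the DRIVE inequality
(P2) `2(1−ε_C)·F_fix x ≤ Σ_va centralCoeff L σ σ₄ va M_x · frameGrad fixFrameStd M_x va` holds, then `VirialFluxGap.PeriodicSoftness` holds BY NAME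
((P3) = w2 g53 ✓`central_divergence_window`; (P4), smoothness, patching, generic field, cut-offs, scale = Parts I–VIII).  CONDITIONAL on (P2).
[cite: Luscher1983, §2] -/
theorem periodicSoftness_of_drive
    (h : ∃ K_C : ℝ, 1 ≤ K_C ∧ ∃ q_C : ℕ, ∃ L₀ : ℕ, ∀ (L : ℕ) [NeZero L], L₀ ≤ L →
      ∃ (ρ t_C ε_C : ℝ),
        (K_C * (L : ℝ) ^ q_C)⁻¹ ≤ ρ ∧ ρ ≤ 1 / 5 ∧ (K_C * (L : ℝ) ^ q_C)⁻¹ ≤ t_C ∧ t_C ≤ (110000 * (L : ℝ) ^ 4)⁻¹ ∧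
        ε_C * (L : ℝ) ^ 4 ≤ 1 / 400 ∧
        ∀ (σ : Fin 3 → ℝ) (σ₄ : ℝ), (∀ k, σ k = 1 ∨ σ k = -1) → (σ₄ = 1 ∨ σ₄ = -1) →
          ∀ x : (OffIdx L → SU2) × ((Fin (2 * L - 1) → GaugeConfig 3 L SU2) × (Site 3 L → SU2)),
          (∀ k : Fin 3, 1 - (su2Quat (wrapReps ((Fin.cons (glue x.1) x.2.1 : Fin (2 * L - 1 + 1) → GaugeConfig 3 L SU2) 0) k)).re ^ 2 ≤ ρ ^ 2) →
          1 - (su2Quat (x.2.2 0)).re ^ 2 ≤ ρ ^ 2 →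
          (∀ k : Fin 3, 1 / 2 ≤ σ k * (su2Quat (wrapReps ((Fin.cons (glue x.1) x.2.1 : Fin (2 * L - 1 + 1) → GaugeConfig 3 L SU2) 0) k)).re) →
          1 / 2 ≤ σ₄ * (su2Quat (x.2.2 0)).re →
          ringDeficit L (fun _ => false) ((Fin.cons (glue x.1) x.2.1 : Fin (2 * L - 1 + 1) → GaugeConfig 3 L SU2), x.2.2) ≤ t_C →
          2 * (1 - ε_C) * ringDeficit L (fun _ => false) ((Fin.cons (glue x.1) x.2.1 : Fin (2 * L - 1 + 1) → GaugeConfig 3 L SU2), x.2.2) ≤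
            ∑ va, centralCoeff L σ σ₄ va (ringCoord L ((Fin.cons (glue x.1) x.2.1 : Fin (2 * L - 1 + 1) → GaugeConfig 3 L SU2), x.2.2)) *
              frameGrad (L := L) fixFrameStd (ringCoord L ((Fin.cons (glue x.1) x.2.1 : Fin (2 * L - 1 + 1) → GaugeConfig 3 L SU2), x.2.2)) va) :
    Summit.QuantumFields.YangMills.Theses.VirialFluxGap.PeriodicSoftness := by
  obtain ⟨K_C, hK_C, q_C, L₀, hpack⟩ := h
  refine periodicSoftness_of_centralDrive ⟨K_C, hK_C, q_C, L₀, fun L _ hL => ?_⟩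
  obtain ⟨ρ, t_C, ε_C, hρlo, hρ5, htClo, htChi, hεC, hP⟩ := hpack L hL
  have hL1 : (1 : ℝ) ≤ L := by exact_mod_cast NeZero.one_le
  have hL4 : (0 : ℝ) < (L : ℝ) ^ 4 := by positivity
  have hKC0 : 0 < K_C := by linarith
  have hρ0 : 0 ≤ ρ := le_trans (by positivity) hρlo
  have htC' : t_C ≤ (4096 * (L : ℝ) ^ 4)⁻¹ :=
    htChi.trans (by rw [inv_le_inv₀ (by positivity) (by positivity)]; nlinarith [hL4])
  refine ⟨ρ, t_C, ε_C, hρlo, by linarith, htClo, htChi, hεC, fun σ σ₄ hσ hσ₄ x hk hs hhk hhs hF => ⟨hP σ σ₄ hσ hσ₄ x hk hs hhk hhs hF, ?_⟩⟩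
  exact central_divergence_window (L := L) hσ hσ₄ x hρ0 hρ5 htC' hk hs hF

end Summit.QuantumFields.YangMills.Theorems.VirialFluxGap.FrameHessian

end
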